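import Mathlib
import HarnessLib

/-!
# Item `LrcModEntire` (stmt-NavierStokesRegularity-20428) — (Q4) entrance tool: THE INTERIOR CRITICAL POINT OF A FAMILY OF STRICTLY CONCAVE CROSS-SECTIONS IS A
# STRICTLY DIFFERENTIABLE FUNCTION OF THE PARAMETERS (implicit function theorem), with the implicit-differentiation identity

ns-k2-port-2 g6 (helper prover under the LEAD of item 20428, ns-poloidal-K2-p3 g15; `--supports stmt-NavierStokesRegularity-20428 --as helper`).
On the homogeneous ridge web of `…RidgeWebClass.exists_hullLimit_ridgeWeb` every cross-section `n ↦ G(p, n) = F τ (Γ s + nν_Γ s + z e₂)`, `p = (τ, s, z)`, is strictly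
concave on `(−r, r)` and carries a unique interior web point `n₀(p)` (`∂ₙG(p, n₀ p) = 0`).  To treat the web curves `Γ_{τ,z} = {Γ s + n₀(τ,s,z)ν_Γ s + z e₂}` as regular arcs
(memo `Cruxes/LrcModEntire/T2B-g14.md` §10/§14: the web sheet `S_t`, its normal speed, the kernel of the horizontal Hessian along `Γ_{t,z}`) one needs `n₀ ∈ C¹`.  CLASS-FREE:

* `fderiv_partial_apply` — `D(v ↦ DG(v)[w])(u)[h] = D²G(u)[h][w]`;
* `eq_of_partial_eq_zero` — on a parameter value `p` whose cross-section has `∂ₙ∂ₙG(p,·) < 0` on `(−r,r)`, `∂ₙG(p,·)` has at most one zero in `(−r,r)`;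
* `hasStrictFDerivAt_criticalPoint` — **`G : P × ℝ → ℝ` of class `C²` near `{p} × (−r,r)` for `p` in an open `V`, `n₀ : P → ℝ` with `n₀ p ∈ (−r,r)`, `∂ₙG(p, n₀ p) = 0` and
  `∂ₙ∂ₙG(p, n) < 0` (`p ∈ V`, `|n| < r`) ⇒ `n₀` is STRICTLY DIFFERENTIABLE at every `p₀ ∈ V`**, with the derivative of Mathlib's
  `HasStrictFDerivAt.implicitFunctionOfProdDomain` for `f = ∂ₙG` (the implicit function is identified with `n₀` by the uniqueness of the critical point — no a-priori
  continuity of `n₀` is assumed);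
* `fderiv_partial_comp_criticalPoint_eq_zero` — the implicit-differentiation identity `D(∂ₙG)(p₀, n₀ p₀)[(h, Dn₀(p₀)h)] = 0`.

WHAT THIS IS NOT: not a claim about Navier–Stokes regularity — calculus for the entrance of the research cell (Q4) «HOMOGENEOUS NULL RIDGE» (bears_on LADDER-NS N0, item 20428 /
crux 19708; 20428/19708/27893 OPEN; (Q4) OPEN).  No summit statement is proved here.
-/

noncomputable section

-- the summit and its single sub-problem share the name (CONVENTIONS §1), as in every Theorems file
set_option linter.dupNamespace false

namespace Summit.NavierStokesRegularity.NavierStokesRegularity.Theorems.PoloidalWindowDoorLrcModEntireRidgeWebImplicit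

open Set Filter Topology Metric Function

variable {P : Type*} [NormedAddCommGroup P] [NormedSpace ℝ P]

/-- `D(v ↦ DG(v)[w])(u)[h] = D²G(u)[h][w]` when `DG` is differentiable at `u`. [folklore] -/
theorem fderiv_partial_apply {G : P × ℝ → ℝ} {u : P × ℝ} (hG : DifferentiableAt ℝ (fderiv ℝ G) u) (w h : P × ℝ) :
    fderiv ℝ (fun v => fderiv ℝ G v w) u h = fderiv ℝ (fderiv ℝ G) u h w := by
  set A : (P × ℝ →L[ℝ] ℝ) →L[ℝ] ℝ := ContinuousLinearMap.apply ℝ ℝ w with hA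
  have e : (fun v => fderiv ℝ G v w) = A ∘ fderiv ℝ G := by funext v; simp [hA]
  rw [e, (A.hasFDerivAt.comp u hG.hasFDerivAt).fderiv]
  simp [hA]

/-- The partial derivative `n ↦ ∂ₙG(p, n)` has derivative `∂ₙ∂ₙG(p, n)` along the fibre. [folklore] -/
theorem hasDerivAt_partial_fibre {G : P × ℝ → ℝ} {p : P} {n : ℝ} (hG : DifferentiableAt ℝ (fderiv ℝ G) (p, n)) :
    HasDerivAt (fun m : ℝ => fderiv ℝ G (p, m) ((0 : P), (1 : ℝ))) (fderiv ℝ (fderiv ℝ G) (p, n) ((0 : P), (1 : ℝ)) ((0 : P), (1 : ℝ))) n := by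
  have hι : HasDerivAt (fun m : ℝ => ((p, m) : P × ℝ)) ((0 : P), (1 : ℝ)) n := (hasDerivAt_const n p).prodMk (hasDerivAt_id n)
  have hφ : DifferentiableAt ℝ (fun v => fderiv ℝ G v ((0 : P), (1 : ℝ))) (p, n) := by
    set A : (P × ℝ →L[ℝ] ℝ) →L[ℝ] ℝ := ContinuousLinearMap.apply ℝ ℝ ((0 : P), (1 : ℝ)) with hA
    have e : (fun v => fderiv ℝ G v ((0 : P), (1 : ℝ))) = A ∘ fderiv ℝ G := by funext v; simp [hA]
    rw [e]; exact A.differentiableAt.comp _ hG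
  have h := hφ.hasFDerivAt.comp_hasDerivAt n hι
  rw [fderiv_partial_apply hG] at h
  exact h

/-- **At most one critical point per strictly concave cross-section**: if `∂ₙ∂ₙG(p, n) < 0` for `|n| < r` (and `DG` is differentiable there) then `∂ₙG(p,·)` is
strictly decreasing on `(−r, r)`, so two zeros coincide. [folklore] -/
theorem eq_of_partial_eq_zero {G : P × ℝ → ℝ} {p : P} {r : ℝ}
    (hG : ∀ n ∈ Ioo (-r) r, DifferentiableAt ℝ (fderiv ℝ G) (p, n))
    (hconc : ∀ n ∈ Ioo (-r) r, fderiv ℝ (fderiv ℝ G) (p, n) ((0 : P), (1 : ℝ)) ((0 : P), (1 : ℝ)) < 0)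
    {a b : ℝ} (ha : a ∈ Ioo (-r) r) (hb : b ∈ Ioo (-r) r)
    (ha0 : fderiv ℝ G (p, a) ((0 : P), (1 : ℝ)) = 0) (hb0 : fderiv ℝ G (p, b) ((0 : P), (1 : ℝ)) = 0) : a = b := by
  have hanti : StrictAntiOn (fun m : ℝ => fderiv ℝ G (p, m) ((0 : P), (1 : ℝ))) (Ioo (-r) r) := by
    refine strictAntiOn_of_deriv_neg (convex_Ioo _ _) ?_ fun m hm => ?_
    · exact fun m hm => (hasDerivAt_partial_fibre (hG m hm)).continuousAt.continuousWithinAt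
    · rw [interior_Ioo] at hm
      rw [(hasDerivAt_partial_fibre (hG m hm)).deriv]
      exact hconc m hm
  exact hanti.injOn ha hb (ha0.trans hb0.symm)

variable [CompleteSpace P]

/-- **THE CRITICAL POINT IS STRICTLY DIFFERENTIABLE (implicit function theorem).**  `V` open; for `p ∈ V` and `|n| < r`, `G` is `C²` at `(p, n)` and `∂ₙ∂ₙG(p,n) < 0`;
`n₀ p ∈ (−r, r)` with `∂ₙG(p, n₀ p) = 0` for `p ∈ V`.  Then at every `p₀ ∈ V`, `n₀` has the strict derivative `−(f′∘inr)⁻¹ ∘ (f′∘inl)`, `f′ = D(∂ₙG)(p₀, n₀ p₀)`. -/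
theorem hasStrictFDerivAt_criticalPoint {G : P × ℝ → ℝ} {V : Set P} (hV : IsOpen V) {r : ℝ}
    (hG : ∀ p ∈ V, ∀ n ∈ Ioo (-r) r, ContDiffAt ℝ 2 G (p, n))
    (hconc : ∀ p ∈ V, ∀ n ∈ Ioo (-r) r, fderiv ℝ (fderiv ℝ G) (p, n) ((0 : P), (1 : ℝ)) ((0 : P), (1 : ℝ)) < 0)
    {n₀ : P → ℝ} (hn₀ : ∀ p ∈ V, n₀ p ∈ Ioo (-r) r) (hcrit : ∀ p ∈ V, fderiv ℝ G (p, n₀ p) ((0 : P), (1 : ℝ)) = 0)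
    {p₀ : P} (hp₀ : p₀ ∈ V) :
    HasStrictFDerivAt n₀
      (-(fderiv ℝ (fun v => fderiv ℝ G v ((0 : P), (1 : ℝ))) (p₀, n₀ p₀) ∘L ContinuousLinearMap.inr ℝ P ℝ).inverse ∘L
        (fderiv ℝ (fun v => fderiv ℝ G v ((0 : P), (1 : ℝ))) (p₀, n₀ p₀) ∘L ContinuousLinearMap.inl ℝ P ℝ)) p₀ := by
  set f : P × ℝ → ℝ := fun v => fderiv ℝ G v ((0 : P), (1 : ℝ)) with hf
  set u : P × ℝ := (p₀, n₀ p₀) with hu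
  -- `f` is `C¹` at `u`, hence strictly differentiable
  have hGd : ∀ p ∈ V, ∀ n ∈ Ioo (-r) r, DifferentiableAt ℝ (fderiv ℝ G) (p, n) := fun p hp n hn =>
    ((hG p hp n hn).fderiv_right (m := 1) le_rfl).differentiableAt (by simp)
  have hf1 : ContDiffAt ℝ 1 f u := by
    have h := (hG p₀ hp₀ _ (hn₀ p₀ hp₀)).fderiv_right (m := 1) le_rfl
    set A : (P × ℝ →L[ℝ] ℝ) →L[ℝ] ℝ := ContinuousLinearMap.apply ℝ ℝ ((0 : P), (1 : ℝ)) with hA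
    have e : f = A ∘ fderiv ℝ G := by funext v; simp [hf, hA]
    rw [e]; exact A.contDiff.contDiffAt.comp u h
  have dfu : HasStrictFDerivAt f (fderiv ℝ f u) u := hf1.hasStrictFDerivAt (by simp)
  -- the fibre derivative is the (negative) number `∂ₙ∂ₙG(u)`, so `f′ ∘ inr` is invertible
  have if₂u : (fderiv ℝ f u ∘L ContinuousLinearMap.inr ℝ P ℝ).IsInvertible := by
    -- a continuous linear map `ℝ →L[ℝ] ℝ` not vanishing at `1` is multiplication by a unit (cf. `Literature.Geometry.Manifold.isInvertible_of_apply_one_ne_zero`)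
    set L : ℝ →L[ℝ] ℝ := fderiv ℝ f u ∘L ContinuousLinearMap.inr ℝ P ℝ with hL
    have hL1 : L 1 ≠ 0 := by
      rw [hL, ContinuousLinearMap.comp_apply, ContinuousLinearMap.inr_apply, hf, fderiv_partial_apply (hGd p₀ hp₀ _ (hn₀ p₀ hp₀))]
      exact (hconc p₀ hp₀ _ (hn₀ p₀ hp₀)).ne
    refine ⟨ContinuousLinearEquiv.unitsEquivAut ℝ (Units.mk0 (L 1) hL1), ?_⟩
    ext
    simp
  -- the implicit function and its three properties
  have hψt := dfu.tendsto_implicitFunctionOfProdDomain if₂u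
  have hψeq := dfu.eventually_apply_implicitFunctionOfProdDomain if₂u
  have hψd := dfu.hasStrictFDerivAt_implicitFunctionOfProdDomain if₂u
  set ψ := dfu.implicitFunctionOfProdDomain if₂u with hψ
  -- `ψ = n₀` near `p₀`: both are critical points in `(−r, r)` of a strictly concave cross-section
  have hfu : f u = 0 := hcrit p₀ hp₀
  have hev : ∀ᶠ p in 𝓝 p₀, ψ p = n₀ p := by
    have h1 : ∀ᶠ p in 𝓝 p₀, p ∈ V := hV.mem_nhds hp₀
    have h2 : ∀ᶠ p in 𝓝 p₀, ψ p ∈ Ioo (-r) r := hψt (isOpen_Ioo.mem_nhds (hn₀ p₀ hp₀))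
    filter_upwards [h1, h2, hψeq] with p hp hψp hq
    rw [hfu] at hq
    exact eq_of_partial_eq_zero (hGd p hp) (hconc p hp) hψp (hn₀ p hp) hq (hcrit p hp)
  exact hψd.congr_of_eventuallyEq hev

/-- **Implicit differentiation**: under the same hypotheses, `D(∂ₙG)(p₀, n₀ p₀)[(h, Dn₀(p₀) h)] = 0` for every direction `h`. -/
theorem fderiv_partial_comp_criticalPoint_eq_zero {G : P × ℝ → ℝ} {V : Set P} (hV : IsOpen V) {r : ℝ}
    (hG : ∀ p ∈ V, ∀ n ∈ Ioo (-r) r, ContDiffAt ℝ 2 G (p, n))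
    (hconc : ∀ p ∈ V, ∀ n ∈ Ioo (-r) r, fderiv ℝ (fderiv ℝ G) (p, n) ((0 : P), (1 : ℝ)) ((0 : P), (1 : ℝ)) < 0)
    {n₀ : P → ℝ} (hn₀ : ∀ p ∈ V, n₀ p ∈ Ioo (-r) r) (hcrit : ∀ p ∈ V, fderiv ℝ G (p, n₀ p) ((0 : P), (1 : ℝ)) = 0)
    {p₀ : P} (hp₀ : p₀ ∈ V) (h : P) :
    fderiv ℝ (fun v => fderiv ℝ G v ((0 : P), (1 : ℝ))) (p₀, n₀ p₀) (h, fderiv ℝ n₀ p₀ h) = 0 := by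
  have hn₀d : HasFDerivAt n₀ (fderiv ℝ n₀ p₀) p₀ :=
    (hasStrictFDerivAt_criticalPoint hV hG hconc hn₀ hcrit hp₀).hasFDerivAt.differentiableAt.hasFDerivAt
  set f : P × ℝ → ℝ := fun v => fderiv ℝ G v ((0 : P), (1 : ℝ)) with hf
  have hf1 : ContDiffAt ℝ 1 f (p₀, n₀ p₀) := by
    have h := (hG p₀ hp₀ _ (hn₀ p₀ hp₀)).fderiv_right (m := 1) le_rfl
    set A : (P × ℝ →L[ℝ] ℝ) →L[ℝ] ℝ := ContinuousLinearMap.apply ℝ ℝ ((0 : P), (1 : ℝ)) with hA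
    have e : f = A ∘ fderiv ℝ G := by funext v; simp [hf, hA]
    rw [e]; exact A.contDiff.contDiffAt.comp _ h
  have hfd : HasFDerivAt f (fderiv ℝ f (p₀, n₀ p₀)) (p₀, n₀ p₀) := (hf1.differentiableAt (by simp)).hasFDerivAt
  -- the composite `p ↦ f (p, n₀ p)` vanishes on the open set `V`
  have hι : HasFDerivAt (fun p => ((p, n₀ p) : P × ℝ)) ((ContinuousLinearMap.id ℝ P).prod (fderiv ℝ n₀ p₀)) p₀ :=
    (hasFDerivAt_id p₀).prodMk hn₀d
  have hcomp := hfd.comp p₀ hι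
  have hzero : (f ∘ fun p => ((p, n₀ p) : P × ℝ)) =ᶠ[𝓝 p₀] fun _ => (0 : ℝ) := by
    filter_upwards [hV.mem_nhds hp₀] with p hp
    exact hcrit p hp
  have hD : fderiv ℝ (f ∘ fun p => ((p, n₀ p) : P × ℝ)) p₀ = 0 := by
    rw [hzero.fderiv_eq]; exact fderiv_const_apply 0
  have happ := congrArg (fun L : P →L[ℝ] ℝ => L h) (hcomp.fderiv.symm.trans hD)
  simpa using happ

end Summit.NavierStokesRegularity.NavierStokesRegularity.Theorems.PoloidalWindowDoorLrcModEntireRidgeWebImplicit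

end
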